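import Summits.BirchSwinnertonDyer.Rank1Residual.Additive.X3ThreeLineDatum
import Summits.BirchSwinnertonDyer.Rank1Residual.X2.CellAGVParCertificatesN9A
import Mathlib.Tactic.Simproc.Factors
import HarnessLib

/-!
# X3♯(G-ord, `e = 2`) at `p = 3`: kernel records of the per-pair LINE DATUM `X3LineDatumThree W` for the
# Case-1 members of the B-X3G booking list — part P of 16 (cell `bsd-addord`, seat
# `bsd-addord-twist`, strategy = twist transport)

HONEST FRAMING (cell `bsd-addord`, `run/shared/lean/pub/bsd-addord/README.md` §4): the programme's
target of record is the full Birch–Swinnerton-Dyer formula for every `E/ℚ` of analytic rank `≤ 1`.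
DATA-RECORDS module: theorems only (no definition, no named fact, no `sorry`); it BOOKS NOTHING and
moves no mark — booking is the planner's act (TARGET.md v5.5 §8 protocol B-X3G, (iv)).

## What is recorded

For each isogeny class `(N, class, 3)` of the booking list `HOME/bsd-addord-twist-booking-members.tsv`
(kit job j242057; the r_an = 0, non-CM, non-degenerate branch-parity classes of cell (G-ord, `e = 2`) at
`p = 3` in census v2, planner keys `HOME/planner/bx3g/`), the CASE-1 MEMBER `W = [a₁, a₂, a₃, a₄, a₆]`
(Cremona's globally minimal model; the first member in Cremona order carrying the EVEN rational `3`-line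
as a SUB-line) and the theorem `X3LineDatumThree W` — SOME rational `3`-line `Φ₀ ≤ W[3]` which is even,
has non-trivial `Γ_ℚ`-action and `χ_{−3}`-twist ramified at `3` — proved by
`x3LineDatumThree_of_cert_of_delta` from the certificate `(x₀, s, D, q)`: `Ψ₃(x₀) = 0`, `D` squarefree,
`s ≠ 0`, `D·s² = Ψ₂Sq(x₀)`, `0 < D`, `D ≠ 1`, `3 ∤ D` (`norm_num` identities, one prime-factor-list
computation with X2a's helper `squarefree_of_nodup_primeFactorsList_natAbs`, `decide`s). This is the per-pair line-datum input of
`ClassX3Gord.{{missingLowerBoundAt,bsdp}}_three_rankZero_of_facts_of_nonAnomalous`; the class binders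
(`ClassX3Gord W 3`, `¬ HasCM`, `analyticRank = 0`, `ReductionNonAnomalous W 3`) are data of record
(Cremona / the planner's two-engine census), NOT kernel statements here; the other members of each class
are reached by Cassels (`N10.bsdp_of_isIsogenous_of_bsdp`, binder `bsdRHS_eq_of_isIsogenous`). The
docstring of each record names the class, the anomalous bit of the twist `V = W ⊗ χ_{−3}` and `D`
(`φ = χ_D`). Records sorted by conductor.

References: [GreenbergVatsal2000] §2 p. 28 (the line `Φ`); lane file
`HOME/bsd-addord-twist-booking-members.tsv`; `Additive/X3ThreeLineDatum.lean`.
-/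

set_option autoImplicit false

open WeierstrassCurve Polynomial Literature.NumberTheory.EllipticCurves
  Literature.NumberTheory.EllipticCurves.Rank1Residual

namespace Summit.BirchSwinnertonDyer.Rank1Residual.Additive.X3ThreeLineDatumRecords

/-- `468846s3` = `[1,-1,0,150003,37492389]` (class `468846s`, (G-ord, `e = 2`) at `3`; twist `52094j3`, `a₃(V) = -2` — ANOMALOUS (outside the end state as typed); even line
`φ = χ_{61}`): `x₀ = 46`, `D = 61`, `s = 1708`, `Ψ₂Sq(x₀) = 177953104` ⇒ `X3LineDatumThree W`. [folklore] -/
theorem x3LineDatumThree_468846s3 : X3LineDatumThree (⟨1, -1, 0, 150003, 37492389⟩ : WeierstrassCurve ℚ) :=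
  x3LineDatumThree_of_cert_of_delta _ (by norm_num [Δ, b₂, b₄, b₆, b₈]) 46 1708 61
    (by simp only [Ψ₃, eval_add, eval_mul, eval_pow, eval_C, eval_X, eval_ofNat]; norm_num [b₂, b₄, b₆, b₈])
    (X2.CellACertN9.squarefree_of_nodup_primeFactorsList_natAbs (by norm_num) (by simp [Nat.primeFactorsList_ofNat])) (by norm_num)
    (by rw [KernelDisc.eval_Ψ₂Sq]; norm_num [b₂, b₄, b₆]) (by decide) (by decide) (by decide)

/-- `469278o2` = `[1,-1,0,67932792873,-38598703934498915]` (class `469278o`, (G-ord, `e = 2`) at `3`; twist `52142m2`, `a₃(V) = -1`, non-anomalous; even line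
`φ = χ_{29}`): `x₀ = 457294`, `D = 29`, `s = 110231552`, `Ψ₂Sq(x₀) = 352378856633532416` ⇒ `X3LineDatumThree W`. [folklore] -/
theorem x3LineDatumThree_469278o2 : X3LineDatumThree (⟨1, -1, 0, 67932792873, -38598703934498915⟩ : WeierstrassCurve ℚ) :=
  x3LineDatumThree_of_cert_of_delta _ (by norm_num [Δ, b₂, b₄, b₆, b₈]) 457294 110231552 29
    (by simp only [Ψ₃, eval_add, eval_mul, eval_pow, eval_C, eval_X, eval_ofNat]; norm_num [b₂, b₄, b₆, b₈])
    (X2.CellACertN9.squarefree_of_nodup_primeFactorsList_natAbs (by norm_num) (by simp [Nat.primeFactorsList_ofNat])) (by norm_num)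
    (by rw [KernelDisc.eval_Ψ₂Sq]; norm_num [b₂, b₄, b₆]) (by decide) (by decide) (by decide)

/-- `469278x2` = `[1,-1,0,-999520668,12163111898512]` (class `469278x`, (G-ord, `e = 2`) at `3`; twist `52142n2`, `a₃(V) = -1`, non-anomalous; even line
`φ = χ_{29}`): `x₀ = 18292`, `D = 29`, `s = 3364`, `Ψ₂Sq(x₀) = 328178384` ⇒ `X3LineDatumThree W`. [folklore] -/
theorem x3LineDatumThree_469278x2 : X3LineDatumThree (⟨1, -1, 0, -999520668, 12163111898512⟩ : WeierstrassCurve ℚ) :=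
  x3LineDatumThree_of_cert_of_delta _ (by norm_num [Δ, b₂, b₄, b₆, b₈]) 18292 3364 29
    (by simp only [Ψ₃, eval_add, eval_mul, eval_pow, eval_C, eval_X, eval_ofNat]; norm_num [b₂, b₄, b₆, b₈])
    (X2.CellACertN9.squarefree_of_nodup_primeFactorsList_natAbs (by norm_num) (by simp [Nat.primeFactorsList_ofNat])) (by norm_num)
    (by rw [KernelDisc.eval_Ψ₂Sq]; norm_num [b₂, b₄, b₆]) (by decide) (by decide) (by decide)

/-- `470925bm2` = `[0,0,1,-9273900,-13262313344]` (class `470925bm`, (G-ord, `e = 2`) at `3`; twist `52325c2`, `a₃(V) = -1`, non-anomalous; even line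
`φ = χ_{5}`): `x₀ = 5415`, `D = 5`, `s = 276115`, `Ψ₂Sq(x₀) = 381197466125` ⇒ `X3LineDatumThree W`. [folklore] -/
theorem x3LineDatumThree_470925bm2 : X3LineDatumThree (⟨0, 0, 1, -9273900, -13262313344⟩ : WeierstrassCurve ℚ) :=
  x3LineDatumThree_of_cert_of_delta _ (by norm_num [Δ, b₂, b₄, b₆, b₈]) 5415 276115 5
    (by simp only [Ψ₃, eval_add, eval_mul, eval_pow, eval_C, eval_X, eval_ofNat]; norm_num [b₂, b₄, b₆, b₈])
    (X2.CellACertN9.squarefree_of_nodup_primeFactorsList_natAbs (by norm_num) (by simp [Nat.primeFactorsList_ofNat])) (by norm_num)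
    (by rw [KernelDisc.eval_Ψ₂Sq]; norm_num [b₂, b₄, b₆]) (by decide) (by decide) (by decide)

/-- `470925br2` = `[0,0,1,-35898600,128877286531]` (class `470925br`, (G-ord, `e = 2`) at `3`; twist `52325d2`, `a₃(V) = -1`, non-anomalous; even line
`φ = χ_{5}`): `x₀ = 960`, `D = 5`, `s = 276115`, `Ψ₂Sq(x₀) = 381197466125` ⇒ `X3LineDatumThree W`. [folklore] -/
theorem x3LineDatumThree_470925br2 : X3LineDatumThree (⟨0, 0, 1, -35898600, 128877286531⟩ : WeierstrassCurve ℚ) :=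
  x3LineDatumThree_of_cert_of_delta _ (by norm_num [Δ, b₂, b₄, b₆, b₈]) 960 276115 5
    (by simp only [Ψ₃, eval_add, eval_mul, eval_pow, eval_C, eval_X, eval_ofNat]; norm_num [b₂, b₄, b₆, b₈])
    (X2.CellACertN9.squarefree_of_nodup_primeFactorsList_natAbs (by norm_num) (by simp [Nat.primeFactorsList_ofNat])) (by norm_num)
    (by rw [KernelDisc.eval_Ψ₂Sq]; norm_num [b₂, b₄, b₆]) (by decide) (by decide) (by decide)

/-- `470925bs2` = `[0,0,1,-124500,16866031]` (class `470925bs`, (G-ord, `e = 2`) at `3`; twist `52325e2`, `a₃(V) = 2`, non-anomalous; even line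
`φ = χ_{5}`): `x₀ = 240`, `D = 5`, `s = 805`, `Ψ₂Sq(x₀) = 3240125` ⇒ `X3LineDatumThree W`. [folklore] -/
theorem x3LineDatumThree_470925bs2 : X3LineDatumThree (⟨0, 0, 1, -124500, 16866031⟩ : WeierstrassCurve ℚ) :=
  x3LineDatumThree_of_cert_of_delta _ (by norm_num [Δ, b₂, b₄, b₆, b₈]) 240 805 5
    (by simp only [Ψ₃, eval_add, eval_mul, eval_pow, eval_C, eval_X, eval_ofNat]; norm_num [b₂, b₄, b₆, b₈])
    (X2.CellACertN9.squarefree_of_nodup_primeFactorsList_natAbs (by norm_num) (by simp [Nat.primeFactorsList_ofNat])) (by norm_num)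
    (by rw [KernelDisc.eval_Ψ₂Sq]; norm_num [b₂, b₄, b₆]) (by decide) (by decide) (by decide)

/-- `472752gq2` = `[0,0,0,-30616131,65162716738]` (class `472752gq`, (G-ord, `e = 2`) at `3`; twist `52528bb2`, `a₃(V) = 1` — ANOMALOUS (outside the end state as typed); even line
`φ = χ_{7}`): `x₀ = 3549`, `D = 7`, `s = 26264`, `Ψ₂Sq(x₀) = 4828583872` ⇒ `X3LineDatumThree W`. [folklore] -/
theorem x3LineDatumThree_472752gq2 : X3LineDatumThree (⟨0, 0, 0, -30616131, 65162716738⟩ : WeierstrassCurve ℚ) :=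
  x3LineDatumThree_of_cert_of_delta _ (by norm_num [Δ, b₂, b₄, b₆, b₈]) 3549 26264 7
    (by simp only [Ψ₃, eval_add, eval_mul, eval_pow, eval_C, eval_X, eval_ofNat]; norm_num [b₂, b₄, b₆, b₈])
    (X2.CellACertN9.squarefree_of_nodup_primeFactorsList_natAbs (by norm_num) (by simp [Nat.primeFactorsList_ofNat])) (by norm_num)
    (by rw [KernelDisc.eval_Ψ₂Sq]; norm_num [b₂, b₄, b₆]) (by decide) (by decide) (by decide)

/-- `472752gy2` = `[0,0,0,-259896,50931727]` (class `472752gy`, (G-ord, `e = 2`) at `3`; twist `52528ba2`, `a₃(V) = 1` — ANOMALOUS (outside the end state as typed); even line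
`φ = χ_{7}`): `x₀ = 336`, `D = 7`, `s = 938`, `Ψ₂Sq(x₀) = 6158908` ⇒ `X3LineDatumThree W`. [folklore] -/
theorem x3LineDatumThree_472752gy2 : X3LineDatumThree (⟨0, 0, 0, -259896, 50931727⟩ : WeierstrassCurve ℚ) :=
  x3LineDatumThree_of_cert_of_delta _ (by norm_num [Δ, b₂, b₄, b₆, b₈]) 336 938 7
    (by simp only [Ψ₃, eval_add, eval_mul, eval_pow, eval_C, eval_X, eval_ofNat]; norm_num [b₂, b₄, b₆, b₈])
    (X2.CellACertN9.squarefree_of_nodup_primeFactorsList_natAbs (by norm_num) (by simp [Nat.primeFactorsList_ofNat])) (by norm_num)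
    (by rw [KernelDisc.eval_Ψ₂Sq]; norm_num [b₂, b₄, b₆]) (by decide) (by decide) (by decide)

/-- `473382ej2` = `[1,-1,1,726925,14017299]` (class `473382ej`, (G-ord, `e = 2`) at `3`; twist `52598f2`, `a₃(V) = -1`, non-anomalous; even line
`φ = χ_{17}`): `x₀ = 319`, `D = 17`, `s = 8092`, `Ψ₂Sq(x₀) = 1113167888` ⇒ `X3LineDatumThree W`. [folklore] -/
theorem x3LineDatumThree_473382ej2 : X3LineDatumThree (⟨1, -1, 1, 726925, 14017299⟩ : WeierstrassCurve ℚ) :=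
  x3LineDatumThree_of_cert_of_delta _ (by norm_num [Δ, b₂, b₄, b₆, b₈]) 319 8092 17
    (by simp only [Ψ₃, eval_add, eval_mul, eval_pow, eval_C, eval_X, eval_ofNat]; norm_num [b₂, b₄, b₆, b₈])
    (X2.CellACertN9.squarefree_of_nodup_primeFactorsList_natAbs (by norm_num) (by simp [Nat.primeFactorsList_ofNat])) (by norm_num)
    (by rw [KernelDisc.eval_Ψ₂Sq]; norm_num [b₂, b₄, b₆]) (by decide) (by decide) (by decide)

/-- `474300h2` = `[0,0,0,-1187175,-352683250]` (class `474300h`, (G-ord, `e = 2`) at `3`; twist `52700d2`, `a₃(V) = -1`, non-anomalous; even line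
`φ = χ_{5}`): `x₀ = 1815`, `D = 5`, `s = 52700`, `Ψ₂Sq(x₀) = 13886450000` ⇒ `X3LineDatumThree W`. [folklore] -/
theorem x3LineDatumThree_474300h2 : X3LineDatumThree (⟨0, 0, 0, -1187175, -352683250⟩ : WeierstrassCurve ℚ) :=
  x3LineDatumThree_of_cert_of_delta _ (by norm_num [Δ, b₂, b₄, b₆, b₈]) 1815 52700 5
    (by simp only [Ψ₃, eval_add, eval_mul, eval_pow, eval_C, eval_X, eval_ofNat]; norm_num [b₂, b₄, b₆, b₈])
    (X2.CellACertN9.squarefree_of_nodup_primeFactorsList_natAbs (by norm_num) (by simp [Nat.primeFactorsList_ofNat])) (by norm_num)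
    (by rw [KernelDisc.eval_Ψ₂Sq]; norm_num [b₂, b₄, b₆]) (by decide) (by decide) (by decide)

/-- `474300j2` = `[0,0,0,-26625,-8033875]` (class `474300j`, (G-ord, `e = 2`) at `3`; twist `52700e2`, `a₃(V) = -1`, non-anomalous; even line
`φ = χ_{5}`): `x₀ = 375`, `D = 5`, `s = 5270`, `Ψ₂Sq(x₀) = 138864500` ⇒ `X3LineDatumThree W`. [folklore] -/
theorem x3LineDatumThree_474300j2 : X3LineDatumThree (⟨0, 0, 0, -26625, -8033875⟩ : WeierstrassCurve ℚ) :=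
  x3LineDatumThree_of_cert_of_delta _ (by norm_num [Δ, b₂, b₄, b₆, b₈]) 375 5270 5
    (by simp only [Ψ₃, eval_add, eval_mul, eval_pow, eval_C, eval_X, eval_ofNat]; norm_num [b₂, b₄, b₆, b₈])
    (X2.CellACertN9.squarefree_of_nodup_primeFactorsList_natAbs (by norm_num) (by simp [Nat.primeFactorsList_ofNat])) (by norm_num)
    (by rw [KernelDisc.eval_Ψ₂Sq]; norm_num [b₂, b₄, b₆]) (by decide) (by decide) (by decide)

/-- `475650bz2` = `[1,-1,1,-28355,17926647]` (class `475650bz`, (G-ord, `e = 2`) at `3`; twist `52850b2`, `a₃(V) = -1`, non-anomalous; even line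
`φ = χ_{5}`): `x₀ = 4`, `D = 5`, `s = 3775`, `Ψ₂Sq(x₀) = 71253125` ⇒ `X3LineDatumThree W`. [folklore] -/
theorem x3LineDatumThree_475650bz2 : X3LineDatumThree (⟨1, -1, 1, -28355, 17926647⟩ : WeierstrassCurve ℚ) :=
  x3LineDatumThree_of_cert_of_delta _ (by norm_num [Δ, b₂, b₄, b₆, b₈]) 4 3775 5
    (by simp only [Ψ₃, eval_add, eval_mul, eval_pow, eval_C, eval_X, eval_ofNat]; norm_num [b₂, b₄, b₆, b₈])
    (X2.CellACertN9.squarefree_of_nodup_primeFactorsList_natAbs (by norm_num) (by simp [Nat.primeFactorsList_ofNat])) (by norm_num)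
    (by rw [KernelDisc.eval_Ψ₂Sq]; norm_num [b₂, b₄, b₆]) (by decide) (by decide) (by decide)

/-- `475650ce2` = `[1,-1,1,-226130,-463968003]` (class `475650ce`, (G-ord, `e = 2`) at `3`; twist `52850d2`, `a₃(V) = -1`, non-anomalous; even line
`φ = χ_{5}`): `x₀ = 1354`, `D = 5`, `s = 36995`, `Ψ₂Sq(x₀) = 6843150125` ⇒ `X3LineDatumThree W`. [folklore] -/
theorem x3LineDatumThree_475650ce2 : X3LineDatumThree (⟨1, -1, 1, -226130, -463968003⟩ : WeierstrassCurve ℚ) :=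
  x3LineDatumThree_of_cert_of_delta _ (by norm_num [Δ, b₂, b₄, b₆, b₈]) 1354 36995 5
    (by simp only [Ψ₃, eval_add, eval_mul, eval_pow, eval_C, eval_X, eval_ofNat]; norm_num [b₂, b₄, b₆, b₈])
    (X2.CellACertN9.squarefree_of_nodup_primeFactorsList_natAbs (by norm_num) (by simp [Nat.primeFactorsList_ofNat])) (by norm_num)
    (by rw [KernelDisc.eval_Ψ₂Sq]; norm_num [b₂, b₄, b₆]) (by decide) (by decide) (by decide)

/-- `475650cm2` = `[1,-1,1,13270,-674823]` (class `475650cm`, (G-ord, `e = 2`) at `3`; twist `52850h2`, `a₃(V) = 2`, non-anomalous; even line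
`φ = χ_{5}`): `x₀ = 94`, `D = 5`, `s = 1057`, `Ψ₂Sq(x₀) = 5586245` ⇒ `X3LineDatumThree W`. [folklore] -/
theorem x3LineDatumThree_475650cm2 : X3LineDatumThree (⟨1, -1, 1, 13270, -674823⟩ : WeierstrassCurve ℚ) :=
  x3LineDatumThree_of_cert_of_delta _ (by norm_num [Δ, b₂, b₄, b₆, b₈]) 94 1057 5
    (by simp only [Ψ₃, eval_add, eval_mul, eval_pow, eval_C, eval_X, eval_ofNat]; norm_num [b₂, b₄, b₆, b₈])
    (X2.CellACertN9.squarefree_of_nodup_primeFactorsList_natAbs (by norm_num) (by simp [Nat.primeFactorsList_ofNat])) (by norm_num)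
    (by rw [KernelDisc.eval_Ψ₂Sq]; norm_num [b₂, b₄, b₆]) (by decide) (by decide) (by decide)

/-- `477450ce2` = `[1,-1,1,-180005,23478747]` (class `477450ce`, (G-ord, `e = 2`) at `3`; twist `53050c2`, `a₃(V) = 2`, non-anomalous; even line
`φ = χ_{5}`): `x₀ = 454`, `D = 5`, `s = 5305`, `Ψ₂Sq(x₀) = 140715125` ⇒ `X3LineDatumThree W`. [folklore] -/
theorem x3LineDatumThree_477450ce2 : X3LineDatumThree (⟨1, -1, 1, -180005, 23478747⟩ : WeierstrassCurve ℚ) :=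
  x3LineDatumThree_of_cert_of_delta _ (by norm_num [Δ, b₂, b₄, b₆, b₈]) 454 5305 5
    (by simp only [Ψ₃, eval_add, eval_mul, eval_pow, eval_C, eval_X, eval_ofNat]; norm_num [b₂, b₄, b₆, b₈])
    (X2.CellACertN9.squarefree_of_nodup_primeFactorsList_natAbs (by norm_num) (by simp [Nat.primeFactorsList_ofNat])) (by norm_num)
    (by rw [KernelDisc.eval_Ψ₂Sq]; norm_num [b₂, b₄, b₆]) (by decide) (by decide) (by decide)

/-- `479808bs2` = `[0,0,0,17556,224336]` (class `479808bs`, (G-ord, `e = 2`) at `3`; twist `53312cd2`, `a₃(V) = 2`, non-anomalous; even line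
`φ = χ_{14}`): `x₀ = 42`, `D = 14`, `s = 544`, `Ψ₂Sq(x₀) = 4143104` ⇒ `X3LineDatumThree W`. [folklore] -/
theorem x3LineDatumThree_479808bs2 : X3LineDatumThree (⟨0, 0, 0, 17556, 224336⟩ : WeierstrassCurve ℚ) :=
  x3LineDatumThree_of_cert_of_delta _ (by norm_num [Δ, b₂, b₄, b₆, b₈]) 42 544 14
    (by simp only [Ψ₃, eval_add, eval_mul, eval_pow, eval_C, eval_X, eval_ofNat]; norm_num [b₂, b₄, b₆, b₈])
    (X2.CellACertN9.squarefree_of_nodup_primeFactorsList_natAbs (by norm_num) (by simp [Nat.primeFactorsList_ofNat])) (by norm_num)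
    (by rw [KernelDisc.eval_Ψ₂Sq]; norm_num [b₂, b₄, b₆]) (by decide) (by decide) (by decide)

/-- `479808ip3` = `[0,0,0,-2907660,1908106256]` (class `479808ip`, (G-ord, `e = 2`) at `3`; twist `53312cb3`, `a₃(V) = 2`, non-anomalous; even line
`φ = χ_{14}`): `x₀ = 1050`, `D = 14`, `s = 1904`, `Ψ₂Sq(x₀) = 50753024` ⇒ `X3LineDatumThree W`. [folklore] -/
theorem x3LineDatumThree_479808ip3 : X3LineDatumThree (⟨0, 0, 0, -2907660, 1908106256⟩ : WeierstrassCurve ℚ) :=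
  x3LineDatumThree_of_cert_of_delta _ (by norm_num [Δ, b₂, b₄, b₆, b₈]) 1050 1904 14
    (by simp only [Ψ₃, eval_add, eval_mul, eval_pow, eval_C, eval_X, eval_ofNat]; norm_num [b₂, b₄, b₆, b₈])
    (X2.CellACertN9.squarefree_of_nodup_primeFactorsList_natAbs (by norm_num) (by simp [Nat.primeFactorsList_ofNat])) (by norm_num)
    (by rw [KernelDisc.eval_Ψ₂Sq]; norm_num [b₂, b₄, b₆]) (by decide) (by decide) (by decide)

/-- `480150w2` = `[1,-1,0,-182772,30436816]` (class `480150w`, (G-ord, `e = 2`) at `3`; twist `53350h2`, `a₃(V) = 2`, non-anomalous; even line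
`φ = χ_{5}`): `x₀ = 184`, `D = 5`, `s = 1552`, `Ψ₂Sq(x₀) = 12043520` ⇒ `X3LineDatumThree W`. [folklore] -/
theorem x3LineDatumThree_480150w2 : X3LineDatumThree (⟨1, -1, 0, -182772, 30436816⟩ : WeierstrassCurve ℚ) :=
  x3LineDatumThree_of_cert_of_delta _ (by norm_num [Δ, b₂, b₄, b₆, b₈]) 184 1552 5
    (by simp only [Ψ₃, eval_add, eval_mul, eval_pow, eval_C, eval_X, eval_ofNat]; norm_num [b₂, b₄, b₆, b₈])
    (X2.CellACertN9.squarefree_of_nodup_primeFactorsList_natAbs (by norm_num) (by simp [Nat.primeFactorsList_ofNat])) (by norm_num)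
    (by rw [KernelDisc.eval_Ψ₂Sq]; norm_num [b₂, b₄, b₆]) (by decide) (by decide) (by decide)

/-- `480339g2` = `[0,0,1,-235956,46933474]` (class `480339g`, (G-ord, `e = 2`) at `3`; twist `53371a2`, `a₃(V) = 2`, non-anomalous; even line
`φ = χ_{53}`): `x₀ = 159`, `D = 53`, `s = 1007`, `Ψ₂Sq(x₀) = 53744597` ⇒ `X3LineDatumThree W`. [folklore] -/
theorem x3LineDatumThree_480339g2 : X3LineDatumThree (⟨0, 0, 1, -235956, 46933474⟩ : WeierstrassCurve ℚ) :=
  x3LineDatumThree_of_cert_of_delta _ (by norm_num [Δ, b₂, b₄, b₆, b₈]) 159 1007 53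
    (by simp only [Ψ₃, eval_add, eval_mul, eval_pow, eval_C, eval_X, eval_ofNat]; norm_num [b₂, b₄, b₆, b₈])
    (X2.CellACertN9.squarefree_of_nodup_primeFactorsList_natAbs (by norm_num) (by simp [Nat.primeFactorsList_ofNat])) (by norm_num)
    (by rw [KernelDisc.eval_Ψ₂Sq]; norm_num [b₂, b₄, b₆]) (by decide) (by decide) (by decide)

/-- `480636y2` = `[0,0,0,1599,-40547]` (class `480636y`, (G-ord, `e = 2`) at `3`; twist `53404h2`, `a₃(V) = -2` — ANOMALOUS (outside the end state as typed); even line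
`φ = χ_{13}`): `x₀ = 39`, `D = 13`, `s = 158`, `Ψ₂Sq(x₀) = 324532` ⇒ `X3LineDatumThree W`. [folklore] -/
theorem x3LineDatumThree_480636y2 : X3LineDatumThree (⟨0, 0, 0, 1599, -40547⟩ : WeierstrassCurve ℚ) :=
  x3LineDatumThree_of_cert_of_delta _ (by norm_num [Δ, b₂, b₄, b₆, b₈]) 39 158 13
    (by simp only [Ψ₃, eval_add, eval_mul, eval_pow, eval_C, eval_X, eval_ofNat]; norm_num [b₂, b₄, b₆, b₈])
    (X2.CellACertN9.squarefree_of_nodup_primeFactorsList_natAbs (by norm_num) (by simp [Nat.primeFactorsList_ofNat])) (by norm_num)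
    (by rw [KernelDisc.eval_Ψ₂Sq]; norm_num [b₂, b₄, b₆]) (by decide) (by decide) (by decide)

/-- `480960fq2` = `[0,0,0,6288,58376]` (class `480960fq`, (G-ord, `e = 2`) at `3`; twist `53440b2`, `a₃(V) = 2`, non-anomalous; even line
`φ = χ_{2}`): `x₀ = 24`, `D = 2`, `s = 668`, `Ψ₂Sq(x₀) = 892448` ⇒ `X3LineDatumThree W`. [folklore] -/
theorem x3LineDatumThree_480960fq2 : X3LineDatumThree (⟨0, 0, 0, 6288, 58376⟩ : WeierstrassCurve ℚ) :=
  x3LineDatumThree_of_cert_of_delta _ (by norm_num [Δ, b₂, b₄, b₆, b₈]) 24 668 2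
    (by simp only [Ψ₃, eval_add, eval_mul, eval_pow, eval_C, eval_X, eval_ofNat]; norm_num [b₂, b₄, b₆, b₈])
    Int.prime_two.squarefree (by norm_num)
    (by rw [KernelDisc.eval_Ψ₂Sq]; norm_num [b₂, b₄, b₆]) (by decide) (by decide) (by decide)

/-- `481050ba2` = `[1,-1,1,-116105,-254240103]` (class `481050ba`, (G-ord, `e = 2`) at `3`; twist `53450c2`, `a₃(V) = -1`, non-anomalous; even line
`φ = χ_{5}`): `x₀ = 1084`, `D = 5`, `s = 26725`, `Ψ₂Sq(x₀) = 3571128125` ⇒ `X3LineDatumThree W`. [folklore] -/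
theorem x3LineDatumThree_481050ba2 : X3LineDatumThree (⟨1, -1, 1, -116105, -254240103⟩ : WeierstrassCurve ℚ) :=
  x3LineDatumThree_of_cert_of_delta _ (by norm_num [Δ, b₂, b₄, b₆, b₈]) 1084 26725 5
    (by simp only [Ψ₃, eval_add, eval_mul, eval_pow, eval_C, eval_X, eval_ofNat]; norm_num [b₂, b₄, b₆, b₈])
    (X2.CellACertN9.squarefree_of_nodup_primeFactorsList_natAbs (by norm_num) (by simp [Nat.primeFactorsList_ofNat])) (by norm_num)
    (by rw [KernelDisc.eval_Ψ₂Sq]; norm_num [b₂, b₄, b₆]) (by decide) (by decide) (by decide)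

/-- `483525j2` = `[0,0,1,-44605200,114663809281]` (class `483525j`, (G-ord, `e = 2`) at `3`; twist `53725a2`, `a₃(V) = 2`, non-anomalous; even line
`φ = χ_{5}`): `x₀ = 3840`, `D = 5`, `s = 1535`, `Ψ₂Sq(x₀) = 11781125` ⇒ `X3LineDatumThree W`. [folklore] -/
theorem x3LineDatumThree_483525j2 : X3LineDatumThree (⟨0, 0, 1, -44605200, 114663809281⟩ : WeierstrassCurve ℚ) :=
  x3LineDatumThree_of_cert_of_delta _ (by norm_num [Δ, b₂, b₄, b₆, b₈]) 3840 1535 5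
    (by simp only [Ψ₃, eval_add, eval_mul, eval_pow, eval_C, eval_X, eval_ofNat]; norm_num [b₂, b₄, b₆, b₈])
    (X2.CellACertN9.squarefree_of_nodup_primeFactorsList_natAbs (by norm_num) (by simp [Nat.primeFactorsList_ofNat])) (by norm_num)
    (by rw [KernelDisc.eval_Ψ₂Sq]; norm_num [b₂, b₄, b₆]) (by decide) (by decide) (by decide)

/-- `485100ec2` = `[0,0,0,1209075,-377857375]` (class `485100ec`, (G-ord, `e = 2`) at `3`; twist `53900c2`, `a₃(V) = 2`, non-anomalous; even line
`φ = χ_{5}`): `x₀ = 735`, `D = 5`, `s = 26950`, `Ψ₂Sq(x₀) = 3631512500` ⇒ `X3LineDatumThree W`. [folklore] -/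
theorem x3LineDatumThree_485100ec2 : X3LineDatumThree (⟨0, 0, 0, 1209075, -377857375⟩ : WeierstrassCurve ℚ) :=
  x3LineDatumThree_of_cert_of_delta _ (by norm_num [Δ, b₂, b₄, b₆, b₈]) 735 26950 5
    (by simp only [Ψ₃, eval_add, eval_mul, eval_pow, eval_C, eval_X, eval_ofNat]; norm_num [b₂, b₄, b₆, b₈])
    (X2.CellACertN9.squarefree_of_nodup_primeFactorsList_natAbs (by norm_num) (by simp [Nat.primeFactorsList_ofNat])) (by norm_num)
    (by rw [KernelDisc.eval_Ψ₂Sq]; norm_num [b₂, b₄, b₆]) (by decide) (by decide) (by decide)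

/-- `485100ie2` = `[0,0,0,-14071575,27522062750]` (class `485100ie`, (G-ord, `e = 2`) at `3`; twist `53900b2`, `a₃(V) = -1`, non-anomalous; even line
`φ = χ_{5}`): `x₀ = 735`, `D = 5`, `s = 118580`, `Ψ₂Sq(x₀) = 70306082000` ⇒ `X3LineDatumThree W`. [folklore] -/
theorem x3LineDatumThree_485100ie2 : X3LineDatumThree (⟨0, 0, 0, -14071575, 27522062750⟩ : WeierstrassCurve ℚ) :=
  x3LineDatumThree_of_cert_of_delta _ (by norm_num [Δ, b₂, b₄, b₆, b₈]) 735 118580 5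
    (by simp only [Ψ₃, eval_add, eval_mul, eval_pow, eval_C, eval_X, eval_ofNat]; norm_num [b₂, b₄, b₆, b₈])
    (X2.CellACertN9.squarefree_of_nodup_primeFactorsList_natAbs (by norm_num) (by simp [Nat.primeFactorsList_ofNat])) (by norm_num)
    (by rw [KernelDisc.eval_Ψ₂Sq]; norm_num [b₂, b₄, b₆]) (by decide) (by decide) (by decide)

/-- `485550bs2` = `[1,-1,0,-13038192,-19278166784]` (class `485550bs`, (G-ord, `e = 2`) at `3`; twist `53950v2`, `a₃(V) = 2`, non-anomalous; even line
`φ = χ_{5}`): `x₀ = 6304`, `D = 5`, `s = 345280`, `Ψ₂Sq(x₀) = 596091392000` ⇒ `X3LineDatumThree W`. [folklore] -/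
theorem x3LineDatumThree_485550bs2 : X3LineDatumThree (⟨1, -1, 0, -13038192, -19278166784⟩ : WeierstrassCurve ℚ) :=
  x3LineDatumThree_of_cert_of_delta _ (by norm_num [Δ, b₂, b₄, b₆, b₈]) 6304 345280 5
    (by simp only [Ψ₃, eval_add, eval_mul, eval_pow, eval_C, eval_X, eval_ofNat]; norm_num [b₂, b₄, b₆, b₈])
    (X2.CellACertN9.squarefree_of_nodup_primeFactorsList_natAbs (by norm_num) (by simp [Nat.primeFactorsList_ofNat])) (by norm_num)
    (by rw [KernelDisc.eval_Ψ₂Sq]; norm_num [b₂, b₄, b₆]) (by decide) (by decide) (by decide)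

/-- `486720dg2` = `[0,0,0,-1766388,891331688]` (class `486720dg`, (G-ord, `e = 2`) at `3`; twist `54080bl2`, `a₃(V) = -1`, non-anomalous; even line
`φ = χ_{2}`): `x₀ = 1014`, `D = 2`, `s = 16900`, `Ψ₂Sq(x₀) = 571220000` ⇒ `X3LineDatumThree W`. [folklore] -/
theorem x3LineDatumThree_486720dg2 : X3LineDatumThree (⟨0, 0, 0, -1766388, 891331688⟩ : WeierstrassCurve ℚ) :=
  x3LineDatumThree_of_cert_of_delta _ (by norm_num [Δ, b₂, b₄, b₆, b₈]) 1014 16900 2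
    (by simp only [Ψ₃, eval_add, eval_mul, eval_pow, eval_C, eval_X, eval_ofNat]; norm_num [b₂, b₄, b₆, b₈])
    Int.prime_two.squarefree (by norm_num)
    (by rw [KernelDisc.eval_Ψ₂Sq]; norm_num [b₂, b₄, b₆]) (by decide) (by decide) (by decide)

/-- `486720dj2` = `[0,0,0,5351892,-620116432]` (class `486720dj`, (G-ord, `e = 2`) at `3`; twist `54080bm2`, `a₃(V) = 2`, non-anomalous; even line
`φ = χ_{2}`): `x₀ = 1014`, `D = 2`, `s = 108160`, `Ψ₂Sq(x₀) = 23397171200` ⇒ `X3LineDatumThree W`. [folklore] -/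
theorem x3LineDatumThree_486720dj2 : X3LineDatumThree (⟨0, 0, 0, 5351892, -620116432⟩ : WeierstrassCurve ℚ) :=
  x3LineDatumThree_of_cert_of_delta _ (by norm_num [Δ, b₂, b₄, b₆, b₈]) 1014 108160 2
    (by simp only [Ψ₃, eval_add, eval_mul, eval_pow, eval_C, eval_X, eval_ofNat]; norm_num [b₂, b₄, b₆, b₈])
    Int.prime_two.squarefree (by norm_num)
    (by rw [KernelDisc.eval_Ψ₂Sq]; norm_num [b₂, b₄, b₆]) (by decide) (by decide) (by decide)

/-- `486720fd2` = `[0,0,0,-520609908,4572110913032]` (class `486720fd`, (G-ord, `e = 2`) at `3`; twist `54080bk2`, `a₃(V) = -1`, non-anomalous; even line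
`φ = χ_{26}`): `x₀ = 13182`, `D = 26`, `s = 676`, `Ψ₂Sq(x₀) = 11881376` ⇒ `X3LineDatumThree W`. [folklore] -/
theorem x3LineDatumThree_486720fd2 : X3LineDatumThree (⟨0, 0, 0, -520609908, 4572110913032⟩ : WeierstrassCurve ℚ) :=
  x3LineDatumThree_of_cert_of_delta _ (by norm_num [Δ, b₂, b₄, b₆, b₈]) 13182 676 26
    (by simp only [Ψ₃, eval_add, eval_mul, eval_pow, eval_C, eval_X, eval_ofNat]; norm_num [b₂, b₄, b₆, b₈])
    (X2.CellACertN9.squarefree_of_nodup_primeFactorsList_natAbs (by norm_num) (by simp [Nat.primeFactorsList_ofNat])) (by norm_num)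
    (by rw [KernelDisc.eval_Ψ₂Sq]; norm_num [b₂, b₄, b₆]) (by decide) (by decide) (by decide)

/-- `486720if3` = `[0,0,0,-20200908,33543831152]` (class `486720if`, (G-ord, `e = 2`) at `3`; twist `54080bn3`, `a₃(V) = 2`, non-anomalous; even line
`φ = χ_{26}`): `x₀ = 3822`, `D = 26`, `s = 43264`, `Ψ₂Sq(x₀) = 48666116096` ⇒ `X3LineDatumThree W`. [folklore] -/
theorem x3LineDatumThree_486720if3 : X3LineDatumThree (⟨0, 0, 0, -20200908, 33543831152⟩ : WeierstrassCurve ℚ) :=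
  x3LineDatumThree_of_cert_of_delta _ (by norm_num [Δ, b₂, b₄, b₆, b₈]) 3822 43264 26
    (by simp only [Ψ₃, eval_add, eval_mul, eval_pow, eval_C, eval_X, eval_ofNat]; norm_num [b₂, b₄, b₆, b₈])
    (X2.CellACertN9.squarefree_of_nodup_primeFactorsList_natAbs (by norm_num) (by simp [Nat.primeFactorsList_ofNat])) (by norm_num)
    (by rw [KernelDisc.eval_Ψ₂Sq]; norm_num [b₂, b₄, b₆]) (by decide) (by decide) (by decide)

/-- `487872qb2` = `[0,0,0,1549284,-382540048]` (class `487872qb`, (G-ord, `e = 2`) at `3`; twist `54208bl2`, `a₃(V) = 2`, non-anomalous; even line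
`φ = χ_{2}`): `x₀ = 726`, `D = 2`, `s = 47432`, `Ψ₂Sq(x₀) = 4499589248` ⇒ `X3LineDatumThree W`. [folklore] -/
theorem x3LineDatumThree_487872qb2 : X3LineDatumThree (⟨0, 0, 0, 1549284, -382540048⟩ : WeierstrassCurve ℚ) :=
  x3LineDatumThree_of_cert_of_delta _ (by norm_num [Δ, b₂, b₄, b₆, b₈]) 726 47432 2
    (by simp only [Ψ₃, eval_add, eval_mul, eval_pow, eval_C, eval_X, eval_ofNat]; norm_num [b₂, b₄, b₆, b₈])
    Int.prime_two.squarefree (by norm_num)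
    (by rw [KernelDisc.eval_Ψ₂Sq]; norm_num [b₂, b₄, b₆]) (by decide) (by decide) (by decide)

/-- `494190ce2` = `[1,-1,0,-7230834,7485755890]` (class `494190ce`, (G-ord, `e = 2`) at `3`; twist `54910u2`, `a₃(V) = -1`, non-anomalous; even line
`φ = χ_{17}`): `x₀ = 1543`, `D = 17`, `s = 323`, `Ψ₂Sq(x₀) = 1773593` ⇒ `X3LineDatumThree W`. [folklore] -/
theorem x3LineDatumThree_494190ce2 : X3LineDatumThree (⟨1, -1, 0, -7230834, 7485755890⟩ : WeierstrassCurve ℚ) :=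
  x3LineDatumThree_of_cert_of_delta _ (by norm_num [Δ, b₂, b₄, b₆, b₈]) 1543 323 17
    (by simp only [Ψ₃, eval_add, eval_mul, eval_pow, eval_C, eval_X, eval_ofNat]; norm_num [b₂, b₄, b₆, b₈])
    (X2.CellACertN9.squarefree_of_nodup_primeFactorsList_natAbs (by norm_num) (by simp [Nat.primeFactorsList_ofNat])) (by norm_num)
    (by rw [KernelDisc.eval_Ψ₂Sq]; norm_num [b₂, b₄, b₆]) (by decide) (by decide) (by decide)

/-- `494190cf2` = `[1,-1,0,-38351799,91425261703]` (class `494190cf`, (G-ord, `e = 2`) at `3`; twist `54910v2`, `a₃(V) = -1`, non-anomalous; even line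
`φ = χ_{17}`): `x₀ = 3685`, `D = 17`, `s = 5491`, `Ψ₂Sq(x₀) = 512568377` ⇒ `X3LineDatumThree W`. [folklore] -/
theorem x3LineDatumThree_494190cf2 : X3LineDatumThree (⟨1, -1, 0, -38351799, 91425261703⟩ : WeierstrassCurve ℚ) :=
  x3LineDatumThree_of_cert_of_delta _ (by norm_num [Δ, b₂, b₄, b₆, b₈]) 3685 5491 17
    (by simp only [Ψ₃, eval_add, eval_mul, eval_pow, eval_C, eval_X, eval_ofNat]; norm_num [b₂, b₄, b₆, b₈])
    (X2.CellACertN9.squarefree_of_nodup_primeFactorsList_natAbs (by norm_num) (by simp [Nat.primeFactorsList_ofNat])) (by norm_num)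
    (by rw [KernelDisc.eval_Ψ₂Sq]; norm_num [b₂, b₄, b₆]) (by decide) (by decide) (by decide)

/-- `494190ei2` = `[1,-1,1,-1686803,845900331]` (class `494190ei`, (G-ord, `e = 2`) at `3`; twist `54910n2`, `a₃(V) = -1`, non-anomalous; even line
`φ = χ_{17}`): `x₀ = 625`, `D = 17`, `s = 2890`, `Ψ₂Sq(x₀) = 141985700` ⇒ `X3LineDatumThree W`. [folklore] -/
theorem x3LineDatumThree_494190ei2 : X3LineDatumThree (⟨1, -1, 1, -1686803, 845900331⟩ : WeierstrassCurve ℚ) :=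
  x3LineDatumThree_of_cert_of_delta _ (by norm_num [Δ, b₂, b₄, b₆, b₈]) 625 2890 17
    (by simp only [Ψ₃, eval_add, eval_mul, eval_pow, eval_C, eval_X, eval_ofNat]; norm_num [b₂, b₄, b₆, b₈])
    (X2.CellACertN9.squarefree_of_nodup_primeFactorsList_natAbs (by norm_num) (by simp [Nat.primeFactorsList_ofNat])) (by norm_num)
    (by rw [KernelDisc.eval_Ψ₂Sq]; norm_num [b₂, b₄, b₆]) (by decide) (by decide) (by decide)

/-- `494550b2` = `[1,-1,0,32508,-798584]` (class `494550b`, (G-ord, `e = 2`) at `3`; twist `54950o2`, `a₃(V) = -1`, non-anomalous; even line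
`φ = χ_{5}`): `x₀ = 94`, `D = 5`, `s = 1570`, `Ψ₂Sq(x₀) = 12324500` ⇒ `X3LineDatumThree W`. [folklore] -/
theorem x3LineDatumThree_494550b2 : X3LineDatumThree (⟨1, -1, 0, 32508, -798584⟩ : WeierstrassCurve ℚ) :=
  x3LineDatumThree_of_cert_of_delta _ (by norm_num [Δ, b₂, b₄, b₆, b₈]) 94 1570 5
    (by simp only [Ψ₃, eval_add, eval_mul, eval_pow, eval_C, eval_X, eval_ofNat]; norm_num [b₂, b₄, b₆, b₈])
    (X2.CellACertN9.squarefree_of_nodup_primeFactorsList_natAbs (by norm_num) (by simp [Nat.primeFactorsList_ofNat])) (by norm_num)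
    (by rw [KernelDisc.eval_Ψ₂Sq]; norm_num [b₂, b₄, b₆]) (by decide) (by decide) (by decide)

/-- `494550bj2` = `[1,-1,0,-1526928417,22965310216741]` (class `494550bj`, (G-ord, `e = 2`) at `3`; twist `54950m2`, `a₃(V) = -1`, non-anomalous; even line
`φ = χ_{5}`): `x₀ = 23404`, `D = 5`, `s = 196250`, `Ψ₂Sq(x₀) = 192570312500` ⇒ `X3LineDatumThree W`. [folklore] -/
theorem x3LineDatumThree_494550bj2 : X3LineDatumThree (⟨1, -1, 0, -1526928417, 22965310216741⟩ : WeierstrassCurve ℚ) :=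
  x3LineDatumThree_of_cert_of_delta _ (by norm_num [Δ, b₂, b₄, b₆, b₈]) 23404 196250 5
    (by simp only [Ψ₃, eval_add, eval_mul, eval_pow, eval_C, eval_X, eval_ofNat]; norm_num [b₂, b₄, b₆, b₈])
    (X2.CellACertN9.squarefree_of_nodup_primeFactorsList_natAbs (by norm_num) (by simp [Nat.primeFactorsList_ofNat])) (by norm_num)
    (by rw [KernelDisc.eval_Ψ₂Sq]; norm_num [b₂, b₄, b₆]) (by decide) (by decide) (by decide)

/-- `494550bl2` = `[1,-1,0,-4222692,2986843216]` (class `494550bl`, (G-ord, `e = 2`) at `3`; twist `54950n2`, `a₃(V) = -1`, non-anomalous; even line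
`φ = χ_{5}`): `x₀ = 1984`, `D = 5`, `s = 43960`, `Ψ₂Sq(x₀) = 9662408000` ⇒ `X3LineDatumThree W`. [folklore] -/
theorem x3LineDatumThree_494550bl2 : X3LineDatumThree (⟨1, -1, 0, -4222692, 2986843216⟩ : WeierstrassCurve ℚ) :=
  x3LineDatumThree_of_cert_of_delta _ (by norm_num [Δ, b₂, b₄, b₆, b₈]) 1984 43960 5
    (by simp only [Ψ₃, eval_add, eval_mul, eval_pow, eval_C, eval_X, eval_ofNat]; norm_num [b₂, b₄, b₆, b₈])
    (X2.CellACertN9.squarefree_of_nodup_primeFactorsList_natAbs (by norm_num) (by simp [Nat.primeFactorsList_ofNat])) (by norm_num)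
    (by rw [KernelDisc.eval_Ψ₂Sq]; norm_num [b₂, b₄, b₆]) (by decide) (by decide) (by decide)

/-- `494550bw2` = `[1,-1,0,-15712317,25216070341]` (class `494550bw`, (G-ord, `e = 2`) at `3`; twist `54950q2`, `a₃(V) = 2`, non-anomalous; even line
`φ = χ_{5}`): `x₀ = 1354`, `D = 5`, `s = 71680`, `Ψ₂Sq(x₀) = 25690112000` ⇒ `X3LineDatumThree W`. [folklore] -/
theorem x3LineDatumThree_494550bw2 : X3LineDatumThree (⟨1, -1, 0, -15712317, 25216070341⟩ : WeierstrassCurve ℚ) :=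
  x3LineDatumThree_of_cert_of_delta _ (by norm_num [Δ, b₂, b₄, b₆, b₈]) 1354 71680 5
    (by simp only [Ψ₃, eval_add, eval_mul, eval_pow, eval_C, eval_X, eval_ofNat]; norm_num [b₂, b₄, b₆, b₈])
    (X2.CellACertN9.squarefree_of_nodup_primeFactorsList_natAbs (by norm_num) (by simp [Nat.primeFactorsList_ofNat])) (by norm_num)
    (by rw [KernelDisc.eval_Ψ₂Sq]; norm_num [b₂, b₄, b₆]) (by decide) (by decide) (by decide)

/-- `495846d2` = `[1,-1,0,-539226,-71747532]` (class `495846d`, (G-ord, `e = 2`) at `3`; twist `55094g2`, `a₃(V) = -2` — ANOMALOUS (outside the end state as typed); even line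
`φ = χ_{13}`): `x₀ = 1180`, `D = 13`, `s = 16952`, `Ψ₂Sq(x₀) = 3735813952` ⇒ `X3LineDatumThree W`. [folklore] -/
theorem x3LineDatumThree_495846d2 : X3LineDatumThree (⟨1, -1, 0, -539226, -71747532⟩ : WeierstrassCurve ℚ) :=
  x3LineDatumThree_of_cert_of_delta _ (by norm_num [Δ, b₂, b₄, b₆, b₈]) 1180 16952 13
    (by simp only [Ψ₃, eval_add, eval_mul, eval_pow, eval_C, eval_X, eval_ofNat]; norm_num [b₂, b₄, b₆, b₈])
    (X2.CellACertN9.squarefree_of_nodup_primeFactorsList_natAbs (by norm_num) (by simp [Nat.primeFactorsList_ofNat])) (by norm_num)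
    (by rw [KernelDisc.eval_Ψ₂Sq]; norm_num [b₂, b₄, b₆]) (by decide) (by decide) (by decide)

/-- `498240l2` = `[0,0,0,82932,95274992]` (class `498240l`, (G-ord, `e = 2`) at `3`; twist `55360e2`, `a₃(V) = -1`, non-anomalous; even line
`φ = χ_{2}`): `x₀ = 6`, `D = 2`, `s = 13840`, `Ψ₂Sq(x₀) = 383091200` ⇒ `X3LineDatumThree W`. [folklore] -/
theorem x3LineDatumThree_498240l2 : X3LineDatumThree (⟨0, 0, 0, 82932, 95274992⟩ : WeierstrassCurve ℚ) :=
  x3LineDatumThree_of_cert_of_delta _ (by norm_num [Δ, b₂, b₄, b₆, b₈]) 6 13840 2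
    (by simp only [Ψ₃, eval_add, eval_mul, eval_pow, eval_C, eval_X, eval_ofNat]; norm_num [b₂, b₄, b₆, b₈])
    Int.prime_two.squarefree (by norm_num)
    (by rw [KernelDisc.eval_Ψ₂Sq]; norm_num [b₂, b₄, b₆]) (by decide) (by decide) (by decide)

end Summit.BirchSwinnertonDyer.Rank1Residual.Additive.X3ThreeLineDatumRecords
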